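import Mathlib
import Summits.AnomalousDissipation.AnomalousDissipation.Theorems.PointSinkSolitonTransplantCoreEnergyFlux
import Summits.AnomalousDissipation.AnomalousDissipation.Theorems.PointSinkSolitonTransplantStubSolitonCoreFamily
import Summits.AnomalousDissipation.AnomalousDissipation.Theorems.ConeDesingularisation.Negative.BlowdownShells

/-!
# Flux transfer III: the smooth-cutoff energy flux of an `L³ × L^{3/2}`-fed cone equals `D`

Part of the flux-transfer package for the crux `ConeDesingularisation ↔ CascadeSoliton`
(stmt-AnomalousDissipation-19034/19036, route `PointSink`); headline and overview in
`…/ConeDesingularisation/Negative/FedConeFlux.lean`.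

`fedCone_smoothFlux_eq_dissipation`: along the exact blow-down family of a steady smooth
unit-viscosity Navier–Stokes solution with the `R^{5/3}` envelope (`stub_solitonCoreFamily`) the
inward cubic energy flux through a fixed smooth shell cutoff tends to `D = ∫ |∇Q|²`
(`coreFamily_energyFlux_tendsto`); if the solution is matched to a DSS pair `(V, Π)` in `L²`, `L³`
and (pressure) `L^{3/2}` on the geometric shells, the same pairings converge to the cone's flux
(`flux_pairing_tendsto`), so `∫ (½‖V‖² + Π) Dψ[V] = D`. [folklore]
-/

-- `Summit.<Summit>.<Problem>` is the tree's mandated summit-side namespace (CONVENTIONS §2).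
set_option linter.dupNamespace false

noncomputable section

namespace Summit.AnomalousDissipation.AnomalousDissipation.Theorems.ConeDesingularisation.Negative

open MeasureTheory Filter Topology Set Metric
open scoped InnerProductSpace ContDiff
open Literature.Analysis.FunctionSpaces Literature.Analysis.FluidPDE
open Summit.AnomalousDissipation.AnomalousDissipation.Theorems

/-! ### §4 Flux transfer: the smooth-cutoff energy flux of an `L³ × L^{3/2}`-fed cone is `D` -/

/-- **Flux transfer.** Let `(Q, P)` be a smooth steady unit-viscosity zero-force Navier–Stokes
solution on `ℝ³` with the `R^{5/3}` mass envelope and finite dissipation `D = ∫ |∇Q|²`, and let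
`(V, Π)` be a discretely self-similar pair (`V(λx) = λ^{-2/3} V x`, `Π(λx) = λ^{-4/3} Π x` off the
origin, `λ > 1`, `‖V‖² , ‖V‖³, |Π|^{3/2} ∈ L¹_loc(ℝ³∖0)`) to which `(Q, P)` is asymptotic on the
shells `λ^k < ‖x‖ < λ^{k+1}` in `L²` (the `CascadeSoliton` clause), in `L³`
(`(λ^k)⁻¹ ∫_{shell k} ‖Q − V‖³ → 0`) and in `L^{3/2}` for the pressure
(`(λ^k)⁻¹ ∫_{shell k} |P − Π|^{3/2} → 0`). Then for every smooth `ψ` with `ψ = 1` on `‖x‖ < r`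
(`r > 1`) and `ψ = 0` on `‖x‖ > b` (`b < λ²`):
`∫ (½‖V‖² + Π) Dψ[V] = D`.
Proof: along the exact core family `Q_j = (λ^j)^{2/3} Q(λ^j ·)`, `P_j = (λ^j)^{4/3} P(λ^j ·)`
(viscosity `(λ^j)^{-1/3} → 0`, `stub_solitonCoreFamily`) the inward flux
`∫ (½‖Q_j‖² + P_j) Dψ[Q_j] → D` (`coreFamily_energyFlux_tendsto`), while `Dψ` lives on the double
shell `1 < ‖y‖ < λ²`, where `Q_j → V` in `L³` and `P_j → Π` in `L^{3/2}` (change of variables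
`cubicDefect_dilate` / `presDefect_dilate` from the shell clauses at `j` and `j + 1`), so the same
pairings tend to `∫ (½‖V‖² + Π) Dψ[V]` (`flux_pairing_tendsto`). [folklore] -/
theorem fedCone_smoothFlux_eq_dissipation {Q : EuclideanSpace ℝ (Fin 3) → EuclideanSpace ℝ (Fin 3)} {P : EuclideanSpace ℝ (Fin 3) → ℝ}
    (hNS : IsClassicalNSSolutionOn Set.univ 1 (fun _ _ => 0) (fun _ => Q) (fun _ => P))
    (hmass : ∃ C : ℝ, ∀ R : ℝ, 1 ≤ R → ∫ x in ball (0 : EuclideanSpace ℝ (Fin 3)) R, ‖Q x‖ ^ 2 ≤ C * R ^ (5 / 3 : ℝ))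
    (hDint : Integrable (fun x => frobeniusNormSq (fderiv ℝ Q x)))
    {lam : ℝ} {V : EuclideanSpace ℝ (Fin 3) → EuclideanSpace ℝ (Fin 3)} {Pc : EuclideanSpace ℝ (Fin 3) → ℝ} (hlam : 1 < lam)
    (hVm : AEStronglyMeasurable V volume) (hPcm : AEStronglyMeasurable Pc volume)
    (hV : ∀ x : EuclideanSpace ℝ (Fin 3), x ≠ 0 → V (lam • x) = lam ^ (-(2 / 3 : ℝ)) • V x)
    (hPc : ∀ x : EuclideanSpace ℝ (Fin 3), x ≠ 0 → Pc (lam • x) = lam ^ (-(4 / 3 : ℝ)) * Pc x)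
    (hV2 : LocallyIntegrableOn (fun x => ‖V x‖ ^ 2) {x : EuclideanSpace ℝ (Fin 3) | x ≠ 0} volume)
    (hV3 : LocallyIntegrableOn (fun x => ‖V x‖ ^ 3) {x : EuclideanSpace ℝ (Fin 3) | x ≠ 0} volume)
    (hPc32 : LocallyIntegrableOn (fun x => |Pc x| ^ (3 / 2 : ℝ)) {x : EuclideanSpace ℝ (Fin 3) | x ≠ 0} volume)
    (hL2 : Tendsto (fun k : ℕ => (lam ^ k) ^ (-(5 / 3 : ℝ)) *
      ∫ x in {x : EuclideanSpace ℝ (Fin 3) | lam ^ k < ‖x‖ ∧ ‖x‖ < lam ^ (k + 1)}, ‖Q x - V x‖ ^ 2) atTop (𝓝 0))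
    (hL3 : Tendsto (fun k : ℕ => (lam ^ k)⁻¹ *
      ∫ x in {x : EuclideanSpace ℝ (Fin 3) | lam ^ k < ‖x‖ ∧ ‖x‖ < lam ^ (k + 1)}, ‖Q x - V x‖ ^ 3) atTop (𝓝 0))
    (hP32 : Tendsto (fun k : ℕ => (lam ^ k)⁻¹ *
      ∫ x in {x : EuclideanSpace ℝ (Fin 3) | lam ^ k < ‖x‖ ∧ ‖x‖ < lam ^ (k + 1)}, |P x - Pc x| ^ (3 / 2 : ℝ))
      atTop (𝓝 0))
    {ψ : EuclideanSpace ℝ (Fin 3) → ℝ} (hψ : ContDiff ℝ ∞ ψ) {r b : ℝ} (hr : 1 < r) (hb : b < lam ^ 2)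
    (hψ1 : ∀ x : EuclideanSpace ℝ (Fin 3), ‖x‖ < r → ψ x = 1) (hψ0 : ∀ x : EuclideanSpace ℝ (Fin 3), b < ‖x‖ → ψ x = 0) :
    ∫ x, (2⁻¹ * ‖V x‖ ^ 2 + Pc x) * fderiv ℝ ψ x (V x) = ∫ x, frobeniusNormSq (fderiv ℝ Q x) := by
  have hlam0 : 0 < lam := one_pos.trans hlam
  -- the exact core family and its inward energy flux
  obtain ⟨hν, hν0, hcore, hInt, hD, hconc, hball⟩ :=
    stub_solitonCoreFamily Q P hNS hmass hDint lam V hlam hVm hV hV2 hL2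
  set u : ℕ → EuclideanSpace ℝ (Fin 3) → EuclideanSpace ℝ (Fin 3) := fun j y => (lam ^ j) ^ (2 / 3 : ℝ) • Q (lam ^ j • y) with hu_def
  set p : ℕ → EuclideanSpace ℝ (Fin 3) → ℝ := fun j y => (lam ^ j) ^ (4 / 3 : ℝ) * P (lam ^ j • y) with hp_def
  have hQc : Continuous Q := (hNS.contDiff_velocity (Set.mem_univ (0 : ℝ))).continuous
  have hPcont : Continuous P := (hNS.contDiff_pressure (Set.mem_univ (0 : ℝ))).continuous
  have huc : ∀ j, Continuous (u j) := fun j => by simp only [hu_def]; fun_prop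
  have hpc : ∀ j, Continuous (p j) := fun j => by simp only [hp_def]; fun_prop
  have hψc : HasCompactSupport ψ := by
    refine HasCompactSupport.of_support_subset_isCompact (isCompact_closedBall (0 : EuclideanSpace ℝ (Fin 3)) b)
      fun x hx => ?_
    by_contra h
    exact hx (hψ0 x (not_le.1 fun h' => h (mem_closedBall_zero_iff.2 h')))
  have hbdd := coreFamily_locallyBoundedEnergy u huc V hVm
    (fun R hR => dssCone_normSq_integrableOn_ball hlam hV hV2 hR) hball
  have hflux : Tendsto (fun j => ∫ x, (2⁻¹ * ‖u j x‖ ^ 2 + p j x) * fderiv ℝ ψ x (u j x)) atTop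
      (𝓝 (∫ x, frobeniusNormSq (fderiv ℝ Q x))) :=
    coreFamily_energyFlux_tendsto _ u p hν hν0 hcore hInt hD hconc hbdd hψ hψc
      (zero_lt_one.trans hr) hψ1
  -- the test field `Dψ` lives on the double shell `A`
  set A : Set (EuclideanSpace ℝ (Fin 3)) := {y : EuclideanSpace ℝ (Fin 3) | 1 < ‖y‖ ∧ ‖y‖ < lam ^ 2} with hA
  have hψ1' : ContDiff ℝ 1 ψ := hψ.of_le (by exact_mod_cast le_top)
  have hwc : HasCompactSupport (fderiv ℝ ψ) := hψc.fderiv (𝕜 := ℝ)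
  have hw : Continuous (fderiv ℝ ψ) := hψ1'.continuous_fderiv one_ne_zero
  have hwA : ∀ x ∉ A, fderiv ℝ ψ x = 0 := by
    intro x hx
    simp only [hA, Set.mem_setOf_eq, not_and, not_lt] at hx
    by_cases h1 : ‖x‖ ≤ 1
    · have hev : ψ =ᶠ[𝓝 x] fun _ => (1 : ℝ) := by
        filter_upwards [Metric.isOpen_ball.mem_nhds (mem_ball_zero_iff.2 (h1.trans_lt hr))]
          with y hy using hψ1 y (mem_ball_zero_iff.1 hy)
      rw [hev.fderiv_eq]
      simp
    · have h2 : lam ^ 2 ≤ ‖x‖ := hx (not_le.1 h1)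
      have hev : ψ =ᶠ[𝓝 x] fun _ => (0 : ℝ) := by
        filter_upwards [(isOpen_lt continuous_const continuous_norm).mem_nhds (hb.trans_le h2)]
          with y hy using hψ0 y hy
      rw [hev.fderiv_eq]
      simp
  have hV3A : IntegrableOn (fun x => ‖V x‖ ^ 3) A volume :=
    integrableOn_shell_of_locallyIntegrableOn hV3 one_pos _
  have hPcA : IntegrableOn (fun x => |Pc x| ^ (3 / 2 : ℝ)) A volume :=
    integrableOn_shell_of_locallyIntegrableOn hPc32 one_pos _
  -- `L³` convergence of the rescaled velocities on the double shell
  have hdu : Tendsto (fun k => ∫ x in A, ‖u k x - V x‖ ^ 3) atTop (𝓝 0) := by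
    refine tendsto_setIntegral_doubleShell hlam (F := fun k x => ‖u k x - V x‖ ^ 3)
      (fun k x => by positivity)
      (fun k => integrableOn_cubicDefect_shell (huc k) hVm hV3 one_pos _)
      (fun k => integrableOn_cubicDefect_shell (huc k) hVm hV3 hlam0 _) ?_ ?_
    · refine hL3.congr fun k => ?_
      rw [hu_def]
      simp only
      rw [cubicDefect_dilate Q V (pow_pos hlam0 k) (dss_iterate_vel hlam0 hV k) zero_le_one lam,
        mul_one, ← pow_succ]
    · have hsh := ((tendsto_add_atTop_iff_nat 1).2 hL3).const_mul lam
      rw [mul_zero] at hsh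
      refine hsh.congr fun k => ?_
      rw [hu_def]
      simp only
      rw [cubicDefect_dilate Q V (pow_pos hlam0 k) (dss_iterate_vel hlam0 hV k) hlam0.le (lam ^ 2),
        ← pow_succ, ← pow_add, pow_succ, mul_inv, show k + 1 + 1 = k + 2 from rfl]
      have hk : (lam ^ k)⁻¹ ≠ 0 := inv_ne_zero (pow_ne_zero k hlam0.ne')
      field_simp
  -- `L^{3/2}` convergence of the rescaled pressures on the double shell
  have hdp : Tendsto (fun k => ∫ x in A, |p k x - Pc x| ^ (3 / 2 : ℝ)) atTop (𝓝 0) := by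
    refine tendsto_setIntegral_doubleShell hlam (F := fun k x => |p k x - Pc x| ^ (3 / 2 : ℝ))
      (fun k x => by positivity)
      (fun k => integrableOn_presDefect_shell (hpc k) hPcm hPc32 one_pos _)
      (fun k => integrableOn_presDefect_shell (hpc k) hPcm hPc32 hlam0 _) ?_ ?_
    · refine hP32.congr fun k => ?_
      rw [hp_def]
      simp only
      rw [presDefect_dilate P Pc (pow_pos hlam0 k) (dss_iterate_pres hlam0 hPc k) zero_le_one lam,
        mul_one, ← pow_succ]
    · have hsh := ((tendsto_add_atTop_iff_nat 1).2 hP32).const_mul lam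
      rw [mul_zero] at hsh
      refine hsh.congr fun k => ?_
      rw [hp_def]
      simp only
      rw [presDefect_dilate P Pc (pow_pos hlam0 k) (dss_iterate_pres hlam0 hPc k) hlam0.le (lam ^ 2),
        ← pow_succ, ← pow_add, pow_succ, mul_inv, show k + 1 + 1 = k + 2 from rfl]
      have hk : (lam ^ k)⁻¹ ≠ 0 := inv_ne_zero (pow_ne_zero k hlam0.ne')
      field_simp
  have hlim := flux_pairing_tendsto (measurableSet_shell 1 (lam ^ 2)) (isBounded_shell 1 (lam ^ 2))
    huc hpc hVm hPcm hV3A hPcA hdu hdp hw hwc hwA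
  exact tendsto_nhds_unique hlim hflux

end Summit.AnomalousDissipation.AnomalousDissipation.Theorems.ConeDesingularisation.Negative
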